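import Literature.MathematicalPhysics.QuantumFieldTheory.VillainAngleIntegral
import Literature.MathematicalPhysics.QuantumFieldTheory.VillainSheetEnergyBound
import Literature.MathematicalPhysics.QuantumFieldTheory.StrongCouplingInfiniteVolume
import HarnessLib

/-!
# Translation covariance of the free-boundary Villain theory: centred cubes versus the cubes of
# the axial gauge

Support file for the duality transformation of four-dimensional `U(1)` lattice gauge theory with
the Villain action (proof programme of the named fact
`Literature.MathematicalPhysics.QuantumFieldTheory.FrohlichSpencerU1PerimeterLawD4` and of its
corollary `Literature.Barriers.QuantumFields.AbelianDeconfinementD4`). The duality formula and the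
axial gauge (`VillainDuality`, `LatticeAxialGauge`) are written on the cubes
`halfOpenBox d N = [0, N)^d`, the infinite-volume statements on the centred cubes
`box d m = {-m, …, m}^d`; the free-boundary Villain theory is covariant under lattice translations
(FS82 footnote 2 / Osterwalder–Seiler: `⟨F ∘ τ_a⟩_Λ = ⟨F⟩_{Λ - a}`), so the two are the same up to
translating the loop:

* `line_translate`, `rectangle_translate`, `zdWilsonLoop_translate` (holonomies of translated
  configurations), `zdVillainDensity_translate` (`∏_{p ⊂ Λ} φ_β(arg (τ_a U)_p) = ∏_{p ⊂ Λ + a} φ_β(arg U_p)`);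
* `zdVillainExpect_image_add : ⟨F⟩_{Λ + a} = ⟨F ∘ τ_{-a}⟩_Λ` (`β > 0`, `F` measurable; from the
  translation invariance of the Haar product, `map_translate_zdHaar`);
* `zdVillainExpect_wilsonLoop_halfOpenBox :
    ⟨W_γ(x₀ + m·𝟙)⟩_{halfOpenBox d (2m+1)} = ⟨W_γ(x₀)⟩_{box d m}`.

Everything is proved; no named fact is introduced.

## References

* J. Fröhlich, T. Spencer, Comm. Math. Phys. 83 (1982) 411–454, §2.2 (footnote 2, the
  infinite-volume limit over rectangular arrays). [FrohlichSpencerCMP1982]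
* K. Osterwalder, E. Seiler, Ann. Phys. 110 (1978) 440–471, Thm. 3.5 (translation covariance).
  [OsterwalderSeiler1978]
-/

noncomputable section

open MeasureTheory Finset Function
open Literature.Probability.LatticeModels
open Literature.MathematicalPhysics.QuantumLattice (u1Rep continuous_u1Rep)

namespace Literature.MathematicalPhysics.QuantumFieldTheory

/-- Sites of `ℤ^d` (the namespace-local `Site` is the torus one). -/
local notation "ZSite" => Literature.Probability.LatticeModels.Site

namespace VillainAngle

variable {d : ℕ}

/-! ### Holonomies of translated configurations -/

section Holonomy

variable {G : Type*} [Group G]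

/-- Straight-path holonomies of a translated configuration. [folklore] -/
theorem line_translate (a : ZSite d) (U : ZdGaugeConfig d G) (k : Fin d) :
    ∀ (n : ℕ) (y : ZSite d), (ZdGaugeConfig.translate a U).line k n y = U.line k n (y + a)
  | 0, y => rfl
  | n + 1, y => by
    rw [ZdGaugeConfig.line, ZdGaugeConfig.line, line_translate a U k n, add_right_comm]
    rfl

/-- Rectangle holonomies of a translated configuration. [folklore] -/
theorem rectangle_translate (a : ZSite d) (U : ZdGaugeConfig d G) (x : ZSite d) (i j : Fin d)
    (R T : ℕ) : (ZdGaugeConfig.translate a U).rectangle x i j R T = U.rectangle (x + a) i j R T := by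
  simp only [ZdGaugeConfig.rectangle, line_translate, add_right_comm x _ a]

/-- Wilson loops of a translated configuration are Wilson loops of the translated rectangle.
[folklore] -/
theorem zdWilsonLoop_translate {N : ℕ} (ρ : G →* Matrix (Fin N) (Fin N) ℂ) (a : ZSite d)
    (x : ZSite d) (i j : Fin d) (R T : ℕ) (U : ZdGaugeConfig d G) :
    zdWilsonLoop ρ x i j R T (ZdGaugeConfig.translate a U) = zdWilsonLoop ρ (x + a) i j R T U := by
  simp only [zdWilsonLoop, rectangle_translate]

end Holonomy

/-! ### The Villain density and expectation under translations -/

/-- The Villain density of `Λ` at a translated configuration is the density of `Λ + a`. [folklore] -/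
theorem zdVillainDensity_translate (β : ℝ) (Λ : Finset (ZSite d)) (a : ZSite d)
    (U : ZdGaugeConfig d Circle) :
    zdVillainDensity β Λ (ZdGaugeConfig.translate a U) = zdVillainDensity β (Λ.image (· + a)) U := by
  unfold zdVillainDensity
  rw [Plaq.plaquettesIn_image_add, Finset.prod_image (Plaq.shift_injective a).injOn]
  exact Finset.prod_congr rfl fun p _ => by rw [plaquette_translate]; rfl

/-- Translating back: `(Λ + a) + (-a) = Λ`. [folklore] -/
theorem image_add_image_add_neg (Λ : Finset (ZSite d)) (a : ZSite d) :
    (Λ.image (· + a)).image (· + -a) = Λ := by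
  rw [Finset.image_image]
  convert Finset.image_id (s := Λ) using 2
  funext x
  simp

/-- **Translation covariance of the free-boundary Villain expectation**: `⟨F⟩_{Λ + a} = ⟨F ∘ τ_{-a}⟩_Λ`
for `β > 0` and measurable `F`. [cite: OsterwalderSeiler1978, Thm. 3.5] -/
theorem zdVillainExpect_image_add {β : ℝ} (hβ : 0 < β) (Λ : Finset (ZSite d)) (a : ZSite d)
    (F : ZdGaugeConfig d Circle → ℝ) (hF : Measurable F) :
    zdVillainExpect β (Λ.image (· + a)) F =
      zdVillainExpect β Λ (F ∘ ZdGaugeConfig.translate (-a)) := by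
  have hD : ∀ U, zdVillainDensity β (Λ.image (· + a)) (ZdGaugeConfig.translate (-a) U) = zdVillainDensity β Λ U := by
    intro U
    rw [zdVillainDensity_translate, image_add_image_add_neg]
  have hDm : Measurable (zdVillainDensity (d := d) β (Λ.image (· + a))) :=
    (continuous_zdVillainDensity hβ _).measurable
  rw [zdVillainExpect_eq_div hβ, zdVillainExpect_eq_div hβ]
  have h1 : ∫ U, zdVillainDensity β (Λ.image (· + a)) U * F U ∂(zdHaar d Circle) =
      ∫ U, zdVillainDensity β Λ U * (F ∘ ZdGaugeConfig.translate (-a)) U ∂(zdHaar d Circle) := by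
    have h := integral_comp_translate (G := Circle) (-a)
      (f := fun U => zdVillainDensity β (Λ.image (· + a)) U * F U)
      (by exact (hDm.mul hF).aestronglyMeasurable)
    beta_reduce at h
    rw [← h]
    exact integral_congr_ae (Filter.Eventually.of_forall fun U => by simp only [Function.comp_apply, hD])
  have h2 : ∫ U, zdVillainDensity β (Λ.image (· + a)) U ∂(zdHaar d Circle) =
      ∫ U, zdVillainDensity β Λ U ∂(zdHaar d Circle) := by
    have h := integral_comp_translate (G := Circle) (-a)
      (f := zdVillainDensity β (Λ.image (· + a))) hDm.aestronglyMeasurable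
    rw [← h]
    exact integral_congr_ae (Filter.Eventually.of_forall fun U => hD U)
  rw [h1, h2]

/-- **Centred cubes versus axial-gauge cubes for Wilson loops**:
`⟨W_γ(x₀ + m·𝟙)⟩_{halfOpenBox d (2m+1)} = ⟨W_γ(x₀)⟩_{box d m}` (`β > 0`).
[cite: FrohlichSpencerCMP1982, §2.2 (footnote 2)] -/
theorem zdVillainExpect_wilsonLoop_halfOpenBox {β : ℝ} (hβ : 0 < β) (m : ℕ) (x₀ : ZSite d) (i j : Fin d)
    (R T : ℕ) :
    zdVillainExpect β (halfOpenBox d (2 * m + 1)) (zdWilsonLoop u1Rep (x₀ + diag d m) i j R T) =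
      zdVillainExpect β (box d m) (zdWilsonLoop u1Rep x₀ i j R T) := by
  rw [← image_add_diag_box, zdVillainExpect_image_add hβ _ _ _
    (AreaLaw.continuous_zdWilsonLoop u1Rep continuous_u1Rep _ i j R T).measurable]
  congr 1
  funext U
  rw [Function.comp_apply, zdWilsonLoop_translate, add_neg_cancel_right]

end VillainAngle

end Literature.MathematicalPhysics.QuantumFieldTheory
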